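import Mathlib
import Literature.Analysis.FluidPDE.ClassicalSolution
import Literature.Analysis.FluidPDE.ClassicalSolutionCalculus
import Literature.Analysis.FluidPDE.LerayHopf
import Literature.Analysis.FluidPDE.NSWave0
import Literature.Analysis.FluidPDE.KatoFarFieldBound
import Literature.Analysis.FluidPDE.NSCriticalClosureBesovKatoClass
import Summits.NavierStokesRegularity.NavierStokesRegularity.Theses.L3TimeExponentPincer
import Summits.NavierStokesRegularity.NavierStokesRegularity.Theorems.L3TimeExponentPincerJawFarFieldLocal
import Summits.NavierStokesRegularity.NavierStokesRegularity.Theorems.L3TimeExponentPincerEffSatBlowupStubParabolicConcentrationBlowup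
import HarnessLib

/-!
# Spatial localisation of crux `L3CascadeJaw` (stmt-NavierStokesRegularity-19499), UNCONDITIONAL: every frame
# solution is far-field bounded near `T`, so the jaw is decided inside a fixed ball

Support file (cell ns-regularity-ideate, seat ns-pincer-19499-p1 g2), companion of
`L3TimeExponentPincerJawFarFieldLocal` (p478152), which localised the clause to `B̄(0,R)` ASSUMING a far-field
bound.  The assumption is a tree theorem: the frame solution is a Kato solution
(`isKatoSolutionOn_of_classical`, Lemarié-Rieusset 2016 Thm 15.1) and Kato solutions are essentially bounded
on a far field `(T-δ,T) × {|x| > R}` up to the final time (`IsKatoSolutionOn.farField_bound_holds`,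
Rusin–Šverák 2011 §4 / Lemarié-Rieusset 2016 Thm 15.1 (C), proof p. 566 — Calderón splitting + ε-regularity,
PROVED in the tree); joint continuity of the classical field turns the essential bound into a pointwise one
(`norm_le_of_ae_bound_of_continuousOn`).  Hence, kernel-checked and unconditional:

* `farFieldBound_of_frame` — every frame solution has a far-field datum `(R, B, T₁)`:
  `|u(t,x)| ≤ B` for `|x| > R`, `t ∈ (T₁,T)`;
* `exists_radius_jawClauseAt_iff_local` — for every frame solution there is a radius `R` such that for every
  `0 ≤ q < 5` the clause at `q` ⟺ the local clause `∫_{T₂}^T (∫_{B̄(0,R)} |u(t)|³)^{q/3} dt < ∞`;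
* `l3CascadeJaw_iff_local` — the crux BY NAME ⟺ its local form (file p478152's
  `l3CascadeJaw_iff_local_of_farFieldBounded` with the hypothesis discharged).

With the Euler-box triple (p471620/p473776/p475049) the crux is localised in all four coordinates — TIME
(super-Euler times), POSITION (a fixed ball), SCALE (below `r_E = (T-t)^{2/5}`), SPEED (above
`U_E = (T-t)^{-3/5}`) — by tree theorems alone.

WHAT THIS IS NOT: not a claim about Navier–Stokes regularity or blow-up and no progress on the crux's open
content; landed `--supports stmt-NavierStokesRegularity-19499`.
-/

noncomputable section

namespace Summit.NavierStokesRegularity.NavierStokesRegularity.Theorems.L3TimeExponentPincerJawFarFieldLocalHolds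

open MeasureTheory Set Function Filter Metric Topology
open scoped ENNReal NNReal
open Literature.Analysis.FluidPDE
open Summit.NavierStokesRegularity.NavierStokesRegularity.Theses.L3TimeExponentPincer (L3CascadeJaw)
open Summit.NavierStokesRegularity.NavierStokesRegularity.Theorems.L3TimeExponentPincerJawFarFieldLocal
  (jawClauseAt_iff_local_of_farFieldBound l3CascadeJaw_iff_local_of_farFieldBounded)
open Summit.NavierStokesRegularity.NavierStokesRegularity.Theorems.L3TimeExponentPincerStubParabolicConcentration
  (norm_le_of_ae_bound_of_continuousOn)

/-- **Every frame solution is far-field bounded near `T`.**  For a classical solution on `[0,T)`, Leray–Hopf from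
a rapidly decaying datum, there are `R`, `B ≥ 0` and `T₁ < T` with `|u(t,x)| ≤ B` for all `t ∈ (T₁,T)`,
`|x| > R` (Kato class + `IsKatoSolutionOn.farField_bound_holds` + joint continuity).
[cite: RusinSverak2011, §4 p. 6] [cite: LemarieRieusset2016, Thm. 15.1 (C), proof p. 566] -/
theorem farFieldBound_of_frame {ν T : ℝ} (hν : 0 < ν) (hT : 0 < T)
    {u : ℝ → EuclideanSpace ℝ (Fin 3) → EuclideanSpace ℝ (Fin 3)} {p : ℝ → EuclideanSpace ℝ (Fin 3) → ℝ}
    (hcl : IsClassicalNSSolutionOn (Ico 0 T) ν 0 u p) (hLH : IsLerayHopfOn T ν 0 (u 0) u)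
    (hdec : HasRapidSpatialDecay (u 0)) :
    ∃ R B T₁ : ℝ, 0 ≤ B ∧ T₁ < T ∧ ∀ t ∈ Ioo T₁ T, ∀ x, R < ‖x‖ → ‖u t x‖ ≤ B := by
  have hK : IsKatoSolutionOn T ν (u 0) u := isKatoSolutionOn_of_classical hν hT hcl hLH hdec
  obtain ⟨δ, hδ, R, hfar⟩ := IsKatoSolutionOn.farField_bound_holds hν hT hK
  -- the open far region below `T` and above `T₁ = max (T-δ) (T/2) ≥ 0`
  set T₁ : ℝ := max (T - δ) (T / 2) with hT₁
  have hT₁T : T₁ < T := max_lt (by linarith) (by linarith)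
  have hT₁0 : 0 ≤ T₁ := le_max_of_le_right (by linarith)
  set O : Set (ℝ × EuclideanSpace ℝ (Fin 3)) :=
    Ioo T₁ T ×ˢ (closedBall (0 : EuclideanSpace ℝ (Fin 3)) R)ᶜ with hO
  have hOopen : IsOpen O := isOpen_Ioo.prod isClosed_closedBall.isOpen_compl
  have hOsub : O ⊆ Ioo (T - δ) T ×ˢ (closedBall (0 : EuclideanSpace ℝ (Fin 3)) R)ᶜ :=
    prod_mono (Ioo_subset_Ioo_left (le_max_left _ _)) Subset.rfl
  have hOsub' : O ⊆ Ico 0 T ×ˢ (univ : Set (EuclideanSpace ℝ (Fin 3))) :=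
    prod_mono (fun t ht => ⟨hT₁0.trans ht.1.le, ht.2⟩) (subset_univ _)
  have hcont : ContinuousOn (uncurry u) O := hcl.smooth_velocity.continuousOn.mono hOsub'
  -- the essential bound, as a real number
  set E : ℝ≥0∞ := eLpNorm (uncurry u) ∞
    (volume.restrict (Ioo (T - δ) T ×ˢ (closedBall (0 : EuclideanSpace ℝ (Fin 3)) R)ᶜ)) with hE
  have hEtop : E ≠ ⊤ := hfar.ne
  have hae' : ∀ᵐ z ∂(volume.restrict (Ioo (T - δ) T ×ˢ (closedBall (0 : EuclideanSpace ℝ (Fin 3)) R)ᶜ)),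
      ‖uncurry u z‖ ≤ E.toReal := by
    filter_upwards [ae_le_eLpNormEssSup (μ := volume.restrict
      (Ioo (T - δ) T ×ˢ (closedBall (0 : EuclideanSpace ℝ (Fin 3)) R)ᶜ)) (f := uncurry u)] with z hz
    have hz' : ‖uncurry u z‖ₑ ≤ E := by rwa [hE, eLpNorm_exponent_top]
    have := ENNReal.toReal_mono hEtop hz'
    rwa [toReal_enorm] at this
  have hae : ∀ᵐ z ∂(volume.restrict O), ‖uncurry u z‖ ≤ E.toReal :=
    ae_restrict_of_ae_restrict_of_subset hOsub hae'
  have hbound := norm_le_of_ae_bound_of_continuousOn hOopen hcont hae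
  refine ⟨R, max E.toReal 0, T₁, le_max_right _ _, hT₁T, fun t ht x hx => ?_⟩
  have hmem : (t, x) ∈ O := by
    refine mk_mem_prod ht ?_
    rw [mem_compl_iff, mem_closedBall, dist_zero_right, not_le]
    exact hx
  exact (hbound (t, x) hmem).trans (le_max_left _ _)

/-- **For every frame solution the jaw is decided inside a fixed ball.**  There is a radius `R` (the far-field
radius of the solution) such that for every `0 ≤ q < 5`: `∫_{T₂}^T ‖u(t)‖₃^q dt < ∞` on some final window ⟺
`∫_{T₂}^T (∫_{B̄(0,R)} |u(t)|³)^{q/3} dt < ∞` on some final window. -/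
theorem exists_radius_jawClauseAt_iff_local {ν T : ℝ} (hν : 0 < ν) (hT : 0 < T)
    {u : ℝ → EuclideanSpace ℝ (Fin 3) → EuclideanSpace ℝ (Fin 3)} {p : ℝ → EuclideanSpace ℝ (Fin 3) → ℝ}
    (hcl : IsClassicalNSSolutionOn (Ico 0 T) ν 0 u p) (hLH : IsLerayHopfOn T ν 0 (u 0) u)
    (hdec : HasRapidSpatialDecay (u 0)) :
    ∃ R : ℝ, ∀ q : ℝ, 0 ≤ q → q < 5 →
      ((∃ T₂ ∈ Ioo 0 T, (∫⁻ t in Ioo T₂ T, eLpNorm (u t) 3 volume ^ q) < ⊤) ↔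
        ∃ T₂ ∈ Ioo 0 T, (∫⁻ t in Ioo T₂ T,
          (∫⁻ x in closedBall (0 : EuclideanSpace ℝ (Fin 3)) R, ‖u t x‖ₑ ^ 3) ^ (q / 3)) < ⊤) := by
  obtain ⟨R, B, T₁, hB, hT₁, hfar⟩ := farFieldBound_of_frame hν hT hcl hLH hdec
  exact ⟨R, fun q hq0 hq5 => jawClauseAt_iff_local_of_farFieldBound hν hcl hLH hB hT₁ hfar hq0 hq5⟩

/-- **`L3CascadeJaw` ⟺ its local form (unconditional).**  The crux holds iff for every `q ∈ (4,5)`, every frame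
solution and every far-field datum `(R, B, T₁)` of it (`|u(t,x)| ≤ B` for `|x| > R`, `t ∈ (T₁,T)`; such data exist
by `farFieldBound_of_frame`) the LOCAL clause `∫_{T₂}^T (∫_{B̄(0,R)} |u(t)|³)^{q/3} dt < ∞` holds on a final
window. -/
theorem l3CascadeJaw_iff_local :
    L3CascadeJaw ↔
      ∀ q : ℝ, 4 < q → q < 5 → ∀ (ν T : ℝ), 0 < ν → 0 < T →
        ∀ (u : ℝ → EuclideanSpace ℝ (Fin 3) → EuclideanSpace ℝ (Fin 3)) (p : ℝ → EuclideanSpace ℝ (Fin 3) → ℝ),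
          IsClassicalNSSolutionOn (Ico 0 T) ν 0 u p → IsLerayHopfOn T ν 0 (u 0) u →
          HasRapidSpatialDecay (u 0) →
          ∀ R B T₁ : ℝ, 0 ≤ B → T₁ < T → (∀ t ∈ Ioo T₁ T, ∀ x, R < ‖x‖ → ‖u t x‖ ≤ B) →
            ∃ T₂ ∈ Ioo 0 T, (∫⁻ t in Ioo T₂ T,
              (∫⁻ x in closedBall (0 : EuclideanSpace ℝ (Fin 3)) R, ‖u t x‖ₑ ^ 3) ^ (q / 3)) < ⊤ :=
  l3CascadeJaw_iff_local_of_farFieldBounded fun _ _ hν hT _ _ hcl hLH hdec =>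
    farFieldBound_of_frame hν hT hcl hLH hdec

end Summit.NavierStokesRegularity.NavierStokesRegularity.Theorems.L3TimeExponentPincerJawFarFieldLocalHolds

end
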